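import Summits.FinalStateConjecture.FinalStateConjecture.Theorems.KerrShieldedDataExist.Negative.BentSliceConormal
import Literature.Analysis.Calculus.SmoothConvexCutoff
import Literature.Analysis.Calculus.SmoothCutoff
import Mathlib.Analysis.SpecialFunctions.SmoothTransition
import Mathlib.Analysis.Calculus.Deriv.MeanValue
import Mathlib.Analysis.SpecialFunctions.Log.Deriv
import HarnessLib

/-!
# `KerrShieldedDataExist`, line `plug-the-second-sheet` — the bridge annulus, VI: components of the profile

Support file (everything proved) for stub `stub_bridgeAnnulus` of crux `stmt-FinalStateConjecture-10055`:
the concrete component functions of the bridge profile and their calculus.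

* `hasDerivAt_rhoIso`, `two_mul_le_rhoIso`, `rhoIso_le_four_mul` — the sheet-two isotropic→areal map
  `ρI(s) = s(1 + M/2s)² = (2s + M)²/(4s)` (Wald 1984, §6.4), decreasing for `s < M/2`, `ρI ≥ 2M`;
* `hasDerivAt_smoothStep`, `contDiff_smoothStep` — smooth steps `S(a s + b)`, `S = Real.smoothTransition`;
* `hpos_pos`, `contDiff_tauHat`, `hasDerivAt_tauHat` — the outer graph profile
  `τh = (1 − μ) 3(M − r) + μ · 4M log h(r)`, `h` a positive smooth surrogate of `1 − r/2M` (equal to it on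
  `r ≤ M`): `C^∞` on `ℝ`, and inside `{0 < r < M}` steeper than the ingoing null slope
  (`steep_slope_of_convex_combination`, Dafermos–Rodnianski arXiv:0811.0354, §5.1).
-/

-- the doubled `FinalStateConjecture` path component is the summit/problem naming scheme, not a mistake
set_option linter.dupNamespace false

noncomputable section

open Real Set Filter
open scoped Manifold ContDiff Topology InnerProductSpace
open Literature.Geometry.Lorentzian
open Summit.FinalStateConjecture.FinalStateConjecture.Theorems.KerrShieldedDataExist

namespace Summit.FinalStateConjecture.FinalStateConjecture.Theorems.SwallowTheDatum

namespace Bridge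

/-! ### Components of the profile: the isotropic radius, the smooth steps, the outer graph -/

section Components

variable {M ϱ : ℝ}

/-- The two model slopes of the ascending branch are steep enough: the straight segment `t* = 3(M − r)`
(`p = −3`) for `ϱ < M`, and the Kerr–Schild graph `t* = 4M log(1 − r/2M)` (`p = −4M/(2M − ϱ)`) for
`ϱ < 2M`; hence so is every convex combination of them (`ϱ < M`). [cite: arXiv08110354, §5.1] -/
theorem steep_slope_of_convex_combination {μ : ℝ} (hμ0 : 0 ≤ μ) (hμ1 : μ ≤ 1) (hϱ : 0 < ϱ) (hϱM : ϱ < M) :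
    (2 * M - ϱ) * ((1 - μ) * (-3) + μ * (-(4 * M) / (2 * M - ϱ))) + (2 * M + ϱ) < 0 := by
  have h2 : 0 < 2 * M - ϱ := by linarith
  have key : (2 * M - ϱ) * ((1 - μ) * (-3) + μ * (-(4 * M) / (2 * M - ϱ))) + (2 * M + ϱ) =
      (1 - μ) * (-3 * (2 * M - ϱ) + (2 * M + ϱ)) + μ * (-(4 * M) + (2 * M + ϱ)) := by
    field_simp
    ring
  rw [key]
  have hA : -3 * (2 * M - ϱ) + (2 * M + ϱ) < 0 := by linarith
  have hB : -(4 * M) + (2 * M + ϱ) < 0 := by linarith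
  rcases eq_or_lt_of_le hμ0 with h | h
  · rw [← h]; linarith
  · nlinarith


/-- The sheet-two isotropic→areal map `ρI(s) = s(1 + M/2s)² = (2s + M)²/(4s)` has derivative
`(2s − M)(2s + M)/(4s²)` off the origin. [cite: Wald1984, §6.4] -/
theorem hasDerivAt_rhoIso {s : ℝ} (hs : s ≠ 0) :
    HasDerivAt (fun s : ℝ ↦ (2 * s + M) ^ 2 / (4 * s)) ((2 * s - M) * (2 * s + M) / (4 * s ^ 2)) s := by
  have h1 : HasDerivAt (fun s : ℝ ↦ (2 * s + M) ^ 2) (2 * (2 * s + M) + (2 * s + M) * 2) s := by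
    have h := ((hasDerivAt_id' s).const_mul (2 : ℝ)).add_const M
    rw [mul_one] at h
    have h2 := h.fun_mul h
    simpa [pow_two] using h2
  have h2 : HasDerivAt (fun s : ℝ ↦ 4 * s) 4 s := by simpa using (hasDerivAt_id' s).const_mul (4 : ℝ)
  have h := h1.fun_div h2 (by positivity : (4 : ℝ) * s ≠ 0)
  have e : ((2 * (2 * s + M) + (2 * s + M) * 2) * (4 * s) - (2 * s + M) ^ 2 * 4) / (4 * s) ^ 2 =
      (2 * s - M) * (2 * s + M) / (4 * s ^ 2) := by
    field_simp
    ring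
  rw [e] at h
  exact h

/-- `ρI` is `C^∞` off the origin. [folklore] -/
theorem contDiffOn_rhoIso : ContDiffOn ℝ ∞ (fun s : ℝ ↦ (2 * s + M) ^ 2 / (4 * s)) (Ioi 0) :=
  ((contDiffOn_const.mul contDiffOn_id).add contDiffOn_const).pow 2 |>.div
    (contDiffOn_const.mul contDiffOn_id) fun s hs ↦ by have : (0 : ℝ) < s := hs; positivity

/-- `ρI(s) ≥ 2M` for `s > 0` (the throat of the Einstein–Rosen bridge is at areal radius `2M`):
`(2s + M)² − 8Ms = (2s − M)² ≥ 0`. [cite: Wald1984, §6.4] -/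
theorem two_mul_le_rhoIso {s : ℝ} (hs : 0 < s) : 2 * M ≤ (2 * s + M) ^ 2 / (4 * s) := by
  rw [le_div_iff₀ (by positivity)]
  nlinarith [sq_nonneg (2 * s - M)]

/-- `ρI(s) ≤ 4M` for `M/4 ≤ s ≤ M/2` (`M > 0`). [folklore] -/
theorem rhoIso_le_four_mul (hM : 0 < M) {s : ℝ} (h1 : M / 4 ≤ s) (h2 : s ≤ M / 2) :
    (2 * s + M) ^ 2 / (4 * s) ≤ 4 * M := by
  rw [div_le_iff₀ (by linarith)]
  nlinarith [mul_nonneg (sub_nonneg.2 h1) (sub_nonneg.2 h2)]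

/-- The smooth steps `s ↦ S(a s + b)` (`S = Real.smoothTransition`) and their derivative
`S′(a s + b) a ≥ 0` for `a ≥ 0`. [folklore] -/
theorem hasDerivAt_smoothStep (a b s : ℝ) :
    HasDerivAt (fun s : ℝ ↦ Real.smoothTransition (a * s + b)) (deriv Real.smoothTransition (a * s + b) * a) s := by
  have hin : HasDerivAt (fun s : ℝ ↦ a * s + b) a s := by
    simpa using ((hasDerivAt_id' s).const_mul a).add_const b
  exact (Literature.Analysis.Calculus.differentiable_smoothTransition _).hasDerivAt.comp s hin

/-- The smooth steps are `C^∞`. [folklore] -/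
theorem contDiff_smoothStep (a b : ℝ) : ContDiff ℝ ∞ (fun s : ℝ ↦ Real.smoothTransition (a * s + b)) :=
  Real.smoothTransition.contDiff.comp ((contDiff_const.mul contDiff_id).add contDiff_const)

/-- The positive surrogate `h(r) = (1 − w)(1 − r/2M) + w/4`, `w = S(2r/M − 2)`, of `1 − r/2M`
(equal to it for `r ≤ M`, equal to `1/4` for `r ≥ 3M/2`) is positive everywhere (`M > 0`). [folklore] -/
theorem hpos_pos (hM : 0 < M) (r : ℝ) :
    0 < (1 - Real.smoothTransition (2 * r / M - 2)) * (1 - r / (2 * M)) + Real.smoothTransition (2 * r / M - 2) / 4 := by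
  have h0 := Real.smoothTransition.nonneg (2 * r / M - 2)
  have h1 := Real.smoothTransition.le_one (2 * r / M - 2)
  rcases le_or_gt r (3 * M / 2) with hr | hr
  · have h2 : r / (2 * M) ≤ 3 / 4 := by
      rw [div_le_iff₀ (by positivity : (0 : ℝ) < 2 * M)]; linarith
    nlinarith
  · have h3 : Real.smoothTransition (2 * r / M - 2) = 1 := by
      apply Real.smoothTransition.one_of_one_le
      rw [le_sub_iff_add_le, le_div_iff₀ hM]; linarith
    rw [h3]; norm_num

/-- The outer profile `τh(r) = (1 − μ) 3(M − r) + μ G̃(r)`, `μ = S(10r/M − 6)`, `G̃ = 4M log h`, is `C^∞`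
on `ℝ`. [folklore] -/
theorem contDiff_tauHat (hM : 0 < M) :
    ContDiff ℝ ∞ (fun r : ℝ ↦ (1 - Real.smoothTransition (10 / M * r + (-6))) * (3 * (M - r)) +
      Real.smoothTransition (10 / M * r + (-6)) * (4 * M * Real.log
        ((1 - Real.smoothTransition (2 / M * r + (-2))) * (1 - r / (2 * M)) +
          Real.smoothTransition (2 / M * r + (-2)) / 4))) := by
  have hμ := contDiff_smoothStep (10 / M) (-6)
  have hw := contDiff_smoothStep (2 / M) (-2)
  have hh : ContDiff ℝ ∞ (fun r : ℝ ↦ (1 - Real.smoothTransition (2 / M * r + (-2))) * (1 - r / (2 * M)) +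
      Real.smoothTransition (2 / M * r + (-2)) / 4) :=
    ((contDiff_const.sub hw).mul (contDiff_const.sub (contDiff_id.div_const _))).add (hw.div_const _)
  have hlog := hh.log fun r ↦ by
    have := hpos_pos hM r
    have e : 2 / M * r + -2 = 2 * r / M - 2 := by ring
    rw [e]; exact this.ne'
  exact ((contDiff_const.sub hμ).mul (contDiff_const.mul (contDiff_const.sub contDiff_id))).add
    (hμ.mul (contDiff_const.mul hlog))

/-- **The outer profile inside `{r < M}`**: there `h = 1 − r/2M`, and `τh` has derivative
`p = (1 − μ)(−3) + μ(−4M/(2M − r)) + μ′(G(r) − 3(M − r))` with `μ′ ≥ 0` and `G(r) − 3(M − r) < 0`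
(`0 < r < M`), so `(2M − r) p + (2M + r) < 0` (`steep_of_convex_combination`). [cite: arXiv08110354, §5.1] -/
theorem hasDerivAt_tauHat (hM : 0 < M) {r : ℝ} (hr0 : 0 < r) (hrM : r < M) :
    ∃ p : ℝ, HasDerivAt (fun r : ℝ ↦ (1 - Real.smoothTransition (10 / M * r + (-6))) * (3 * (M - r)) +
      Real.smoothTransition (10 / M * r + (-6)) * (4 * M * Real.log
        ((1 - Real.smoothTransition (2 / M * r + (-2))) * (1 - r / (2 * M)) +
          Real.smoothTransition (2 / M * r + (-2)) / 4))) p r ∧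
      (2 * M - r) * p + (2 * M + r) < 0 := by
  -- near `r` the argument of the logarithm is `1 − r/2M`
  have hw0 : ∀ᶠ t in 𝓝 r, Real.smoothTransition (2 / M * t + (-2)) = 0 := by
    filter_upwards [Iio_mem_nhds hrM] with t ht
    have ht' : t < M := ht
    apply Real.smoothTransition.zero_of_nonpos
    have : 2 / M * t ≤ 2 := by rw [div_mul_eq_mul_div, div_le_iff₀ hM]; nlinarith
    linarith
  set μ' := deriv Real.smoothTransition (10 / M * r + (-6)) * (10 / M) with hμ'
  have hμd : HasDerivAt (fun t : ℝ ↦ Real.smoothTransition (10 / M * t + (-6))) μ' r :=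
    hasDerivAt_smoothStep (10 / M) (-6) r
  have hμ'0 : 0 ≤ μ' := mul_nonneg Real.smoothTransition.monotone.deriv_nonneg (by positivity)
  have hμ0 : 0 ≤ Real.smoothTransition (10 / M * r + (-6)) := Real.smoothTransition.nonneg _
  have hμ1 : Real.smoothTransition (10 / M * r + (-6)) ≤ 1 := Real.smoothTransition.le_one _
  -- the logarithmic branch
  have h2M : 0 < 1 - r / (2 * M) := by
    rw [sub_pos, div_lt_one (by positivity)]; linarith
  have hG : HasDerivAt (fun t : ℝ ↦ 4 * M * Real.log ((1 - Real.smoothTransition (2 / M * t + (-2))) * (1 - t / (2 * M)) +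
      Real.smoothTransition (2 / M * t + (-2)) / 4)) (-(4 * M) / (2 * M - r)) r := by
    have hev : (fun t : ℝ ↦ 4 * M * Real.log ((1 - Real.smoothTransition (2 / M * t + (-2))) * (1 - t / (2 * M)) +
        Real.smoothTransition (2 / M * t + (-2)) / 4)) =ᶠ[𝓝 r] fun t ↦ 4 * M * Real.log (1 - t / (2 * M)) := by
      filter_upwards [hw0] with t ht
      simp [ht]
    refine HasDerivAt.congr_of_eventuallyEq ?_ hev
    have h1 : HasDerivAt (fun t : ℝ ↦ 1 - t / (2 * M)) (-(1 / (2 * M))) r := by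
      simpa using ((hasDerivAt_id' r).div_const (2 * M)).const_sub 1
    have h := (h1.log h2M.ne').const_mul (4 * M)
    have hM2 : M * 2 - r ≠ 0 := by linarith
    have e : 4 * M * (-(1 / (2 * M)) / (1 - r / (2 * M))) = -(4 * M) / (2 * M - r) := by
      field_simp
    rw [e] at h
    exact h
  have hval : 4 * M * Real.log ((1 - Real.smoothTransition (2 / M * r + (-2))) * (1 - r / (2 * M)) +
      Real.smoothTransition (2 / M * r + (-2)) / 4) = 4 * M * Real.log (1 - r / (2 * M)) := by
    simp [hw0.self_of_nhds]
  have hlog_neg : Real.log (1 - r / (2 * M)) < 0 :=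
    Real.log_neg h2M (by rw [sub_lt_self_iff]; positivity)
  refine ⟨(1 - Real.smoothTransition (10 / M * r + (-6))) * (-3) +
    Real.smoothTransition (10 / M * r + (-6)) * (-(4 * M) / (2 * M - r)) +
    μ' * (4 * M * Real.log (1 - r / (2 * M)) - 3 * (M - r)), ?_, ?_⟩
  · have hA : HasDerivAt (fun t : ℝ ↦ (1 - Real.smoothTransition (10 / M * t + (-6))) * (3 * (M - t)))
        (-μ' * (3 * (M - r)) + (1 - Real.smoothTransition (10 / M * r + (-6))) * (-3)) r := by
      have h3 : HasDerivAt (fun t : ℝ ↦ 3 * (M - t)) (-3) r := by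
        simpa using ((hasDerivAt_id' r).const_sub M).const_mul (3 : ℝ)
      exact (hμd.const_sub 1).fun_mul h3
    have hB := hμd.fun_mul hG
    have h := hA.fun_add hB
    rw [hval] at h
    exact h.congr_deriv (by ring)
  · have hst := steep_slope_of_convex_combination hμ0 hμ1 hr0 hrM
    have hneg : 4 * M * Real.log (1 - r / (2 * M)) - 3 * (M - r) < 0 := by nlinarith
    have h2 : 0 < 2 * M - r := by linarith
    nlinarith [mul_nonneg hμ'0 h2.le, mul_nonpos_of_nonneg_of_nonpos (mul_nonneg h2.le hμ'0) hneg.le]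

end Components

end Bridge

/-- **Registered export of this file** (sub-goal `bridge_rhoIso` of stub `stub_bridgeAnnulus`): the derivative of the sheet-two isotropic→areal map, `Bridge.hasDerivAt_rhoIso`. [cite: Wald1984, §6.4] -/
theorem bridge_rhoIso :
    ∀ (M s : ℝ), s ≠ 0 → HasDerivAt (fun s : ℝ ↦ (2 * s + M) ^ 2 / (4 * s)) ((2 * s - M) * (2 * s + M) / (4 * s ^ 2)) s :=
  fun _ _ hs ↦ Bridge.hasDerivAt_rhoIso hs

end Summit.FinalStateConjecture.FinalStateConjecture.Theorems.SwallowTheDatum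

end
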